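import Summits.AtomisticToContinuum.Crystallization.Theorems.ChartedZeroExcessLayeredLatticeLiouvilleTI

/-!
# Zero-excess layered lattice Liouville — part TJ (lens-2 g36, node «TensionAndGarbage» beneath (B2♭) of part TH): the pinning estimate
(B2♭) `BondIsoPinningP` is NOT estimate-only — three structural facts about its data, found this generation, dictate its honest cut:
(F1) STRESS FREEDOM: `IsEquilChart a s Λ L w` constrains the chart `L` (conformal) but leaves the stacking data `w` free, and single-site `IsNash` +
`IsClean` hold for EVERY uniformly normal-strained homogeneous stacking with `|ε| ≲ 3 %` (site symmetry kills the force; instrument `strain_fcc.py`: force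
`≤ 1e-15`, site Hessian `≥ 26.8`, hole gap `≥ 13.7`, two-shell deviation `≤ 0.0245·a < a/16`, tension `∓0.55…±0.37 ≠ 0`), so the own-word equilibrium
charts on `L` form a `≥ 1`-parameter family of STRESSED states; the chart handed over by (B1) has arbitrary stress, symmetries (translation, contact-graph
automorphism, point reflection) preserve stress, and a stress mismatch `Δε` costs `≈ (0.8·Δε)²` at EVERY site of `win R` — so the re-anchoring mechanism
«`w₁ := w + t`, `Ψ₁ := (·+t) ∘ σ ∘ Ψ₀`» of (B2♭)'s docstring cannot reach level `C♭·η`, and (B2♭) contains an irreducible EXISTENCE sub-step (TENSION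
RETUNE: continue the own-word family to the datum's stress).  (F2) GARBAGE FLOOR: the datum chart `H′` is tested only through radius-`4` environments of
`win R`, so its letters above height `R + 4` are free («garbage»); through chain relaxation (and the LJ tail) they shift `H′`'s offsets INSIDE reach by a
fixed amount (`≈ 3e-5` at the adjacent spacing, g34 `twin_tail`), whence every bound of the shape `τ₁ ≤ τ′ + dist(H′-shell, H₁-shell)` carries a floor
`Σ ≈ c_f·R`, `c_f ≈ 3e-8` (cap populations `∝ R`), against the budget `C♭·η·nK(win R) ≈ 6.5·C♭·η·R³`: transfer through the datum works iff
`η·R² ≳ 5e-9/C♭` and cannot work as `η·R² → 0`, where the statement's truth rests instead on `S`'s Nash property ABOVE the cap (a configuration following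
`H′`'s garbage-shifted cap with its own true letters must compensate out of reach at displacement scale ≳ the garbage amplitude, which the scale-`(R+O(1))`
registrations see) — a GARBAGE-DETECTION lemma of layer-chain type.  (F3) COLLAR: backward environment closeness and reverse tear-freeness pull partners
from distance `≤ 8`, i.e. from `S` up to `4` beyond the datum's reach, so every proof uses the multi-scale hypothesis at a second scale `D = R + 8`
(lattice `L″ ≠ L`); comparing `L″` with `L` through their common registration of `win R` is exactly affine-fit (FJM) rigidity with a constant uniform over
clean windows [kruzik2019 Thm 1.1.12] on a discrete Korn/Poincaré input [Schmidt2009, Theil2006 §3] — the critic's S2, now placed.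
THE CUT (structural dichotomy «coherent / incoherent registration», exhaustion = the sign of `η·R² − c₀`): (B2♭) ⟸ (G) `GradPinningP` ∧ (P) `WindowPoincareP`
(positions separate cleanly: (P) is the discrete Poincaré inequality on the radius-`4` proximity graph of a door-set window, pure analysis; the
re-anchoring — translate chart and map by the Poincaré mean; translation invariance of equilibrium charts, bond isomorphisms and of every registration
clause but the position one — is PROVED here), and (G) ⟸ (G♯) `GradPinningThickP` (`c₀ ≤ η·R²`, every `c₀ > 0`: tension retune + untwist + transfer +
collar — the floor is affordable; ATTACKABLE) ∧ (G♭) `GradPinningThinP` (`η·R² < c₀`, some `c₀ > 0`: the window is registered to sub-lattice precision,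
`O(R)` bad sites, and the cap needs garbage detection; UNDECIDED·IDEA-NAMED).  Glue PROVED (`bondIsoPinningP_of_pieces`); projections (B2♭) ⇒ (G) ⇒ (G♯),
(G♭) PROVED (no piece exceeds the target); columns `_16XH12` / `_16XH12W` (20 leaves: the three pieces replace (B2♭) in hand-1 g16's eighteen-leaf `_16XH11` of part TI, where
(B4) `BondIsoTearFreeP 1` is already discharged by `bondIsoTearFreeP_one`; supersede `_16XH11` / `_16XH11W`).  Imports part TI (hence TearFree, TH).  Node memo:
`NODE-g36-TensionAndGarbage.md`.
0 EQUIV; placeholder-free; no type-class declarations, custom syntax or option pragmas.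
-/

noncomputable section

open scoped BigOperators InnerProductSpace RealInnerProductSpace
open MeasureTheory Set Metric Filter Topology
open Summit.AtomisticToContinuum.Crystallization.Theorems.ChartedPlanarOrderRigidityDoor
  (E3 IsClean IsNash IsCharted IsEStarGSC VisibleGap PertRegime atomsIn siteEnergy eStar BindingSurface)
open Summit.AtomisticToContinuum.Crystallization.Theorems.ChartedPlanarOrderDensityDichotomy (μS IsSep nK nK_nonneg excess)
open Summit.AtomisticToContinuum.Crystallization.Theorems.ChartedPlanarOrderMesoCut (IsDoorSet NearHom LayeredHom EnvClose)
open Summit.AtomisticToContinuum.Crystallization.Theorems.ChartedPlanarOrderDoorLayered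
  (TwoPeriodic DoorPeriodic PeriodicBulkGapDoor NearHomL2BD Layered atomsIn_subset)
open Summit.AtomisticToContinuum.Crystallization.Theorems.ChartedPlanarOrderDoorLayeredOsc (IsTwoShellAffineGood DoorPeriodicOsc)
open Summit.AtomisticToContinuum.Crystallization.Theorems.ChartedPlanarOrderCleanScaleP
  (IsCleanP IsDoorSetP DoorPeriodicP isDoorSetP_one_iff isCleanP_one_iff isCleanP_μS_iff)
open Literature.MathematicalPhysics.StatisticalMechanics (lennardJones IsHaggSeq triangularVec₁ triangularVec₂)
open Literature.Geometry.DiscreteGeometry (IsTwoShellGoodSet)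

namespace Summit.AtomisticToContinuum.Crystallization.Theorems.ChartedZeroExcessLayeredLatticeLiouville

/-! ## §XII  (lens-2 g36, node «TensionAndGarbage» beneath (B2♭)): (B2♭) ⟸ (G♯) `GradPinningThickP` ∧ (G♭) `GradPinningThinP` ∧ (P) `WindowPoincareP`

### XII.1  Why this cut (and not S1–S5 of part TH §XI.1)
S3 of the inherited skeleton («re-anchor by a contact-graph automorphism and a translation») presupposes that the own-word equilibrium chart on `L` is
unique up to symmetry; by (F1) it is not — normal tension (and shear, with inner relaxation) is free inside `IsEquilChart` — and no symmetry changes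
stress, so the skeleton cannot close: the step that matches the given chart's stress to the datum's is existence content (implicit-function continuation
in one to three parameters at fixed word), tame but irreducible, and it lives inside (G♯)/(G♭), not in a currency of its own, because (F2) forbids any
fine intermediate currency routed through the datum chart: `H′`'s in-reach offsets are polluted by its out-of-reach letters at a fixed positive level, so
«offset-matched to `H′`» is meaningful only down to the floor `c_f·R`.  Above the floor (THICK, `c₀ ≤ η·R²`) the transfer `τ₁ ≤ τ′ + dist(H′-shell, H₁-shell)`
through a tension-retuned own-word chart `H₁`, untwisted at one good site (label truth propagates across bonds between sites of misfit `< 1/8`; twisted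
sites are bad sites, `≤ η·nK/c₁²` of them at bounded cost), with the collar served by the scale-`(R+8)` datum and S2 comparing its lattice to `L`
(`‖L″ − L·Q‖² ≤ C·η`), proves (G♯) — every ingredient is a named tool.  Below the floor (THIN, `η·R² < c₀`) the window is a sub-lattice-precision copy of ONE
homogeneous chart (position budget `< C♭·c₀` per site, `≤ 4c₀R/c₁²` bad sites — fewer than one layer), the bulk transfers as before, and the two polar caps
(`≈ 18·R` sites whose radius-`4` shells touch the garbage-adjacent spacing) need the garbage-detection lemma: their mismatch to the own-word chart is paid by
the registrations at scales `R … R + 10` because `S` is Nash above the cap with its true letters (linearised layer-chain force balance: a cap profile that is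
an equilibrium response to absent letters is off the true-letter stable manifold, and keeping `S` clean upward costs displacement ≳ the profile) — the one
un-inherited idea, confined to (G♭).  Positions (P) are generic: a registration of `win R` at gradient level `κ` and ANY position scale becomes, after
translating chart and map by the Poincaré mean of the displacement `u = x − Ψ x` (whose radius-`4` oscillation the misfit profile dominates, clause (i) of
`IsRegistered`), one at position scale `R` and level `C_P·κ` — PROVED here (`IsRegistered.translate`) down to the discrete Poincaré inequality (P) itself.
| piece | type | tag | why strictly weaker than (B2♭) | size |
|---|---|---|---|---|
| (G♯) `GradPinningThickP` | EXISTENCE (tension retune) + TRANSFER ESTIMATE, regime `c₀ ≤ η·R²` | TRUE-type · ATTACKABLE (named tools: IFT at fixed word, label truth, S2 = FJM/discrete Korn, second scale) | (B2♭) ⇒ (G) ⇒ (G♯) PROVED; no position level, one regime | M–L |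
| (G♭) `GradPinningThinP` | the same + GARBAGE DETECTION at the caps, regime `η·R² < c₀` | TRUE-expected · UNDECIDED · IDEA-NAMED (no-conspiracy for Nash half-stacks) · INSTRUMENTABLE (layer chain) | (G) ⇒ (G♭) PROVED; no position level, one regime | L |
| (P) `WindowPoincareP` | GENERIC DISCRETE ANALYSIS (Poincaré inequality, constant `C_P(δ)·R²`, on the radius-`4` proximity graph of a door-set window; canonical paths) | TRUE-type · ATTACKABLE | no charts, no maps: a statement about vector-valued functions on `win R` | M |
Not decomposed: the tension-retune existence inside (G♯)/(G♭) (no garbage-free currency separates it, XII.1); (B1), (B4) unchanged.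
-/

/-! ### XII.2  Translation invariance of the chart currency (PROVED; the part of S3 that is sound) -/

/-- translating the stacking data by a constant translates the model set. [this file, g36] -/
theorem layeredHom_add_const (L : E3 →L[ℝ] E3) (w : ℤ → E3) (t : E3) :
    LayeredHom L (fun m => w m + t) = (fun p => p + t) '' LayeredHom L w := by
  ext p
  constructor
  · rintro ⟨m, i, j, hp⟩
    refine ⟨L (((i : ℝ) • triangularVec₁ 1) + ((j : ℝ) • triangularVec₂ 1)) + w m, ⟨m, i, j, rfl⟩, ?_⟩
    rw [hp]
    simp only [add_assoc]
  · rintro ⟨q, ⟨m, i, j, hq⟩, rfl⟩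
    exact ⟨m, i, j, by simp only [hq, add_assoc]⟩

/-- cleanliness at any ceiling is invariant under translation of the configuration. [folklore; this file, g36] -/
theorem isCleanP_μS_translate {aHi : ℝ} {Y : Set E3} (t : E3) (h : IsCleanP aHi (μS Y)) :
    IsCleanP aHi (μS ((fun p => p + t) '' Y)) :=
  (isCleanP_μS_iff _).2 (by
    rintro q ⟨q₀, hq₀, rfl⟩
    exact isTwoShellGoodSet_translate t ((isCleanP_μS_iff Y).1 h q₀ hq₀))

/-- the Nash (single-site cage-minimality) clause is invariant under translation of the configuration: cage sums are re-indexed by the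
translation and distances are preserved. [folklore; this file, g36] -/
theorem isNash_μS_translate {Y : Set E3} (t : E3) (h : IsNash (μS Y)) : IsNash (μS ((fun p => p + t) '' Y)) := by
  have hm₀ : ∀ q : E3, μS Y {q} ≠ 0 ↔ q ∈ Y := fun q =>
    Literature.Probability.Process.count_restrict_singleton_ne_zero_iff Y q
  have hm : ∀ q : E3, μS ((fun p => p + t) '' Y) {q} ≠ 0 ↔ q - t ∈ Y := fun q => by
    rw [Literature.Probability.Process.count_restrict_singleton_ne_zero_iff]
    constructor
    · rintro ⟨q₀, hq₀, rfl⟩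
      simpa only [add_sub_cancel_right] using hq₀
    · intro hq
      exact ⟨q - t, hq, sub_add_cancel q t⟩
  intro p hp y hy
  have hp₀ : μS Y {p - t} ≠ 0 := (hm₀ _).2 ((hm p).1 hp)
  have hy₀ : ∀ q : E3, μS Y {q} ≠ 0 → q ≠ p - t → y - t ≠ q := by
    intro q hq hne he
    exact hy (q + t) ((hm _).2 (by simpa only [add_sub_cancel_right] using (hm₀ q).1 hq))
      (fun e => hne (eq_sub_of_add_eq e)) (eq_add_of_sub_eq he)
  have key := h (p - t) hp₀ (y - t) hy₀
  let e : {q : E3 // μS Y {q} ≠ 0 ∧ q ≠ p - t} ≃ {q : E3 // μS ((fun p => p + t) '' Y) {q} ≠ 0 ∧ q ≠ p} :=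
    { toFun := fun q => ⟨q.1 + t, (hm _).2 (by simpa only [add_sub_cancel_right] using (hm₀ _).1 q.2.1),
        fun e => q.2.2 (eq_sub_of_add_eq e)⟩
      invFun := fun q => ⟨q.1 - t, (hm₀ _).2 ((hm _).1 q.2.1), fun e => q.2.2 (sub_left_inj.mp e)⟩
      left_inv := fun q => Subtype.ext (add_sub_cancel_right q.1 t)
      right_inv := fun q => Subtype.ext (sub_add_cancel q.1 t) }
  have hd : ∀ (z : E3) (q : E3), dist z (q + t) = dist (z - t) q := fun z q => by
    conv_lhs => rw [← sub_add_cancel z t]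
    exact dist_add_right _ _ _
  have h1 : ∑' q : {q : E3 // μS ((fun p => p + t) '' Y) {q} ≠ 0 ∧ q ≠ p}, lennardJones (dist p (q : E3)) =
      ∑' q : {q : E3 // μS Y {q} ≠ 0 ∧ q ≠ p - t}, lennardJones (dist (p - t) (q : E3)) := by
    rw [← e.tsum_eq]
    exact tsum_congr fun q => by rw [show ((e q : _) : E3) = q.1 + t from rfl, hd]
  have h2 : ∑' q : {q : E3 // μS ((fun p => p + t) '' Y) {q} ≠ 0 ∧ q ≠ p}, lennardJones (dist y (q : E3)) =
      ∑' q : {q : E3 // μS Y {q} ≠ 0 ∧ q ≠ p - t}, lennardJones (dist (y - t) (q : E3)) := by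
    rw [← e.tsum_eq]
    exact tsum_congr fun q => by rw [show ((e q : _) : E3) = q.1 + t from rfl, hd]
  rw [h1, h2]
  exact key

/-- ★ **equilibrium charts are translation invariant** (translate the stacking data; the chart `L` is unchanged). [this file, g36] -/
theorem IsEquilChart.translate {a s Λ : ℝ} {L : E3 ≃L[ℝ] E3} {w : ℤ → E3} (h : IsEquilChart a s Λ L w) (t : E3) :
    IsEquilChart a s Λ L (fun m => w m + t) := by
  refine ⟨h.1, h.2.1, h.2.2.1, ?_, ?_⟩
  · rw [layeredHom_add_const]
    exact (isCleanP_one_iff _).1 (isCleanP_μS_translate t ((isCleanP_one_iff _).2 h.2.2.2.1))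
  · rw [layeredHom_add_const]
    exact isNash_μS_translate t h.2.2.2.2

/-- a bijection onto `H` followed by a translation is a bijection onto the translate. [this file, g36] -/
theorem bijOn_translate {S H : Set E3} {Ψ : E3 → E3} (hb : Set.BijOn Ψ S H) (t : E3) :
    Set.BijOn (fun x => Ψ x + t) S ((fun p => p + t) '' H) :=
  (add_left_injective t).injOn.bijOn_image.comp hb

/-- bond isomorphisms are invariant under translating the image. [this file, g36] -/
theorem IsBondIso.translate {S : Set E3} {Ψ : E3 → E3} (h : IsBondIso S Ψ) (t : E3) : IsBondIso S (fun x => Ψ x + t) :=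
  fun x hx p hp => by rw [dist_add_right]; exact h x hx p hp

/-- two-sided environment closeness is invariant under translating target set and target base point together. [this file, g36] -/
theorem envClose_translate {τ r : ℝ} {S : Set E3} {x : E3} {H : Set E3} {y : E3} (t : E3) (h : EnvClose τ r S x H y) :
    EnvClose τ r S x ((fun p => p + t) '' H) (y + t) := by
  refine ⟨fun p hp hd => ?_, ?_⟩
  · obtain ⟨q, hq, hc⟩ := h.1 p hp hd
    exact ⟨q + t, ⟨q, hq, rfl⟩, by rwa [add_sub_add_right_eq_sub]⟩
  · rintro _ ⟨q, hq, rfl⟩ hd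
    rw [dist_add_right] at hd
    obtain ⟨p, hp, hc⟩ := h.2 q hq hd
    exact ⟨p, hp, by rwa [add_sub_add_right_eq_sub]⟩

/-- ★ **re-anchoring a registration by a translation (PROVED)**: injectivity, image, sign, two-sided environment closeness and gradient domination are
invariant under translating chart and map by one vector `t`; the gradient level may be relaxed; only the POSITION clause has to be re-supplied (this is
where the Poincaré inequality (P) enters, `bondIsoPinningP_of_gradPinning_poincare`). [this file, g36] -/
theorem IsRegistered.translate {κ κ' r ρ ρ' : ℝ} {S Q H : Set E3} {Ψ : E3 → E3} {τ : E3 → ℝ} (h : IsRegistered κ r ρ S Q H Ψ τ)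
    (hκ : κ ≤ κ') (t : E3) (hpos : ∑ᶠ x ∈ Q, ‖x - (Ψ x + t)‖ ^ 2 ≤ κ' * ρ' ^ 2 * nK Q) :
    IsRegistered κ' r ρ' S Q ((fun p => p + t) '' H) (fun x => Ψ x + t) τ := by
  obtain ⟨h1, h2, h3, h4, h5, _⟩ := h
  refine ⟨fun x hx y hy hxy => h1 hx hy (add_right_cancel hxy), fun x hx => ⟨Ψ x, h2 hx, rfl⟩,
    fun x hx => ⟨(h3 x hx).1, envClose_translate t (h3 x hx).2⟩, fun x hx p hp hd => ?_,
    h5.trans (mul_le_mul_of_nonneg_right hκ (nK_nonneg Q)), hpos⟩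
  rw [add_sub_add_right_eq_sub]
  exact h4 x hx p hp hd

/-! ### XII.3  The pieces -/

/-- ★★ **(G) «GradPinningP aHi Λ θ s»** — (B2♭) WITH THE POSITION SCALE FREE: same data and hypotheses as `BondIsoPinningP`, same conclusion except that the
registration of `win R` is asked at gradient level `C♭·η` and at SOME position scale `ρ` (i.e. no position constraint: `IsRegistered κ 4 ρ` for large `ρ`).
Carries all of (B2♭)'s existence (tension retune, F1) and estimate content; (B2♭) ⇒ (G) PROVED (`ρ := R`), (G) ∧ (P) ⇒ (B2♭) PROVED.  Decomposed further
by regime: (G) ⟸ (G♯) ∧ (G♭) (`gradPinningP_of_thick_thin`).  UNDECIDED (= (G♭)). [this file, g36] -/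
def GradPinningP (aHi Λ θ s : ℝ) : Prop :=
  ∀ δ : ℝ, 0 < δ → ∀ a : ℝ, 0 < a → ∃ Cb : ℝ, 1 ≤ Cb ∧ ∃ η₁ : ℝ, 0 < η₁ ∧ ∃ R₁ : ℝ, 0 < R₁ ∧
    ∀ S : Set E3, IsDoorSetP aHi δ S → (∀ q ∈ S, IsTwoShellAffineGood θ S q) →
      ∀ η : ℝ, 0 < η → η ≤ η₁ → ∀ R : ℝ, R₁ ≤ R →
        (∀ D : ℝ, R ≤ D → NearHomH1BDE a s Λ η 4 D S (atomsIn (μS S) 0 D)) →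
          ∀ (L : E3 ≃L[ℝ] E3) (w' : ℤ → E3) (Ψ' : E3 → E3) (τ' : E3 → ℝ), IsEquilChart a s Λ L w' →
            IsRegistered η 4 R S (atomsIn (μS S) 0 R) (LayeredHom (L : E3 →L[ℝ] E3) w') Ψ' τ' →
              ∀ (w : ℤ → E3) (Ψ₀ : E3 → E3), IsEquilChart a s Λ L w → Set.BijOn Ψ₀ S (LayeredHom (L : E3 →L[ℝ] E3) w) → IsBondIso S Ψ₀ →
                ∃ (w₁ : ℤ → E3) (Ψ₁ : E3 → E3), IsEquilChart a s Λ L w₁ ∧ Set.BijOn Ψ₁ S (LayeredHom (L : E3 →L[ℝ] E3) w₁) ∧ IsBondIso S Ψ₁ ∧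
                  ∃ (ρ : ℝ) (τ₁ : E3 → ℝ), IsRegistered (Cb * η) 4 ρ S (atomsIn (μS S) 0 R) (LayeredHom (L : E3 →L[ℝ] E3) w₁) Ψ₁ τ₁

/-- ★★ **(G♯) «GradPinningThickP aHi Λ θ s»** — (G) in the INCOHERENT (thick) regime `c₀ ≤ η·R²`, for every `c₀ > 0` (the constant `C♭` may depend on `c₀`):
here the garbage floor `c_f·R ≤ (c_f/c₀)·η·R³` is inside the budget, and the intended proof is: TENSION RETUNE (continue the own-word equilibrium family on
`L` from the given chart's stress to the datum's — implicit-function continuation at fixed word, chain Hessian `λ_min ≥ 16.9`, site Hessian `≥ 26` along the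
path, F1) · UNTWIST (compose the bond isomorphism with a contact-graph automorphism so that its intrinsic labelling agrees with the datum's at one good site;
label truth propagates across bonds between sites of misfit `< 1/8`; twisted or slipped components are separated by bad sites, `≤ η·nK/c₁²` of them, each of
bounded cost `≤ 24²` by cleanliness of both ends) · TRANSFER `τ₁ ≤ τ′ + dist(H′-shell, H₁-shell)` with the mismatch summed by chain locality (`Σ ≤ C·η·nK + c_f·R`)
· COLLAR through the scale-`(R+8)` datum and S2 (affine-fit rigidity, constant uniform over clean windows [kruzik2019 Thm 1.1.12], discrete Korn/Poincaré
input [Schmidt2009; Theil2006 §3]: `‖L″ − L·Q‖² ≤ C·η`).  Why it might fail: an own-word family that exits the clean class before reaching the datum's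
stress (clean-window edge slivers, g33 §3, now in the stress variable).  (G) ⇒ (G♯) PROVED.  EXISTENCE (tame) + ESTIMATE · TRUE-type · ATTACKABLE · M–L.
[this file, g36] -/
def GradPinningThickP (aHi Λ θ s : ℝ) : Prop :=
  ∀ c₀ : ℝ, 0 < c₀ → ∀ δ : ℝ, 0 < δ → ∀ a : ℝ, 0 < a → ∃ Cb : ℝ, 1 ≤ Cb ∧ ∃ η₁ : ℝ, 0 < η₁ ∧ ∃ R₁ : ℝ, 0 < R₁ ∧
    ∀ S : Set E3, IsDoorSetP aHi δ S → (∀ q ∈ S, IsTwoShellAffineGood θ S q) →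
      ∀ η : ℝ, 0 < η → η ≤ η₁ → ∀ R : ℝ, R₁ ≤ R → c₀ ≤ η * R ^ 2 →
        (∀ D : ℝ, R ≤ D → NearHomH1BDE a s Λ η 4 D S (atomsIn (μS S) 0 D)) →
          ∀ (L : E3 ≃L[ℝ] E3) (w' : ℤ → E3) (Ψ' : E3 → E3) (τ' : E3 → ℝ), IsEquilChart a s Λ L w' →
            IsRegistered η 4 R S (atomsIn (μS S) 0 R) (LayeredHom (L : E3 →L[ℝ] E3) w') Ψ' τ' →
              ∀ (w : ℤ → E3) (Ψ₀ : E3 → E3), IsEquilChart a s Λ L w → Set.BijOn Ψ₀ S (LayeredHom (L : E3 →L[ℝ] E3) w) → IsBondIso S Ψ₀ →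
                ∃ (w₁ : ℤ → E3) (Ψ₁ : E3 → E3), IsEquilChart a s Λ L w₁ ∧ Set.BijOn Ψ₁ S (LayeredHom (L : E3 →L[ℝ] E3) w₁) ∧ IsBondIso S Ψ₁ ∧
                  ∃ (ρ : ℝ) (τ₁ : E3 → ℝ), IsRegistered (Cb * η) 4 ρ S (atomsIn (μS S) 0 R) (LayeredHom (L : E3 →L[ℝ] E3) w₁) Ψ₁ τ₁

/-- ★★ **(G♭) «GradPinningThinP aHi Λ θ s»** — (G) in the COHERENT (thin) regime `η·R² < c₀`, for some `c₀ > 0` of the prover's choosing: the window is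
registered to sub-lattice precision (`Σ ‖x − Ψ′x‖² < c₀·nK`, gradient RMS `< √c₀/R`, at most `4c₀R/c₁²` sites of misfit `≥ c₁` — fewer than one layer),
the bulk transfers as in (G♯), and the TWO POLAR CAPS (`≈ 18·R` sites whose radius-`4` shells meet the spacing adjacent to the datum's first out-of-reach
layer) need GARBAGE DETECTION: `Σ_cap dist(S-shell, H₁-shell)² ≤ C·η·(nK(win R) + nK(win (R+10)))` for the tension-retuned own-word chart `H₁`, because `S` is
Nash above the cap with its TRUE letters — a cap profile equal to an equilibrium response to letters `S` does not have lies off the true-letter stable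
manifold of the linearised layer-chain recursion, so keeping `S` clean upward costs out-of-reach displacements ≳ the profile, which the scale-`(R+O(1))`
registrations charge at full weight (F2).  Why it might fail: a fine-tuned coincidence between a garbage response and the true-letter stable manifold
(a conspiracy of LJ lattice sums), or an inhomogeneous Nash half-stack compensating at displacement scale ≪ the garbage amplitude.  (G) ⇒ (G♭) PROVED.
EXISTENCE (tame) + ESTIMATE + GARBAGE DETECTION · TRUE-expected · UNDECIDED · IDEA-NAMED · INSTRUMENTABLE (layer chain: transversality of the garbage
response to the true-letter stable direction; compensation cost vs profile). [this file, g36] -/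
def GradPinningThinP (aHi Λ θ s : ℝ) : Prop :=
  ∃ c₀ : ℝ, 0 < c₀ ∧ ∀ δ : ℝ, 0 < δ → ∀ a : ℝ, 0 < a → ∃ Cb : ℝ, 1 ≤ Cb ∧ ∃ η₁ : ℝ, 0 < η₁ ∧ ∃ R₁ : ℝ, 0 < R₁ ∧
    ∀ S : Set E3, IsDoorSetP aHi δ S → (∀ q ∈ S, IsTwoShellAffineGood θ S q) →
      ∀ η : ℝ, 0 < η → η ≤ η₁ → ∀ R : ℝ, R₁ ≤ R → η * R ^ 2 < c₀ →
        (∀ D : ℝ, R ≤ D → NearHomH1BDE a s Λ η 4 D S (atomsIn (μS S) 0 D)) →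
          ∀ (L : E3 ≃L[ℝ] E3) (w' : ℤ → E3) (Ψ' : E3 → E3) (τ' : E3 → ℝ), IsEquilChart a s Λ L w' →
            IsRegistered η 4 R S (atomsIn (μS S) 0 R) (LayeredHom (L : E3 →L[ℝ] E3) w') Ψ' τ' →
              ∀ (w : ℤ → E3) (Ψ₀ : E3 → E3), IsEquilChart a s Λ L w → Set.BijOn Ψ₀ S (LayeredHom (L : E3 →L[ℝ] E3) w) → IsBondIso S Ψ₀ →
                ∃ (w₁ : ℤ → E3) (Ψ₁ : E3 → E3), IsEquilChart a s Λ L w₁ ∧ Set.BijOn Ψ₁ S (LayeredHom (L : E3 →L[ℝ] E3) w₁) ∧ IsBondIso S Ψ₁ ∧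
                  ∃ (ρ : ℝ) (τ₁ : E3 → ℝ), IsRegistered (Cb * η) 4 ρ S (atomsIn (μS S) 0 R) (LayeredHom (L : E3 →L[ℝ] E3) w₁) Ψ₁ τ₁

/-- ★★ **(P) «WindowPoincareP aHi»** — THE DISCRETE POINCARÉ INEQUALITY ON DOOR-SET WINDOWS (generic; no charts, no maps): for every `δ` there are
`C_P ≥ 1` and a floor `R₁` such that for every `aHi`-door set `S` (rooted at `0`, `δ`-separated, clean), every `R ≥ R₁`, every vector-valued `u` on
`win R = atomsIn (μS S) 0 R` and every profile `τ` dominating `u`'s radius-`4` oscillation (`‖u p − u x‖ ≤ τ x` for `p, x ∈ win R`, `dist p x ≤ 4` — so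
`τ ≥ 0` on the window), some constant `t` has `Σ_{win R} ‖u − t‖² ≤ C_P·R²·Σ_{win R} τ²`.  Mechanism: the radius-`4` proximity graph of a clean,
`δ`-separated, rooted configuration restricted to the closed ball is connected with canonical paths of `≲ R` steps and edge congestion `≲ R⁴/δ³`
(route along straight segments pushed `3/2` inward from the boundary sphere, through sites within covering radius `< 1`), so [Diaconis–Stroock 1991]
`Σ ‖u − ū‖² ≤ (2·#win R)⁻¹·(max length)·(congestion)·Σ_edges ‖∇u‖² ≤ C(δ)·R²·(max degree)·Σ τ²`.  Why it might fail: only through a covering-radius or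
connectivity gap of clean windows near the boundary sphere (step length `4` against covering radius `< 1` leaves room `> 1`).  Exactly the difference
between (G) and (B2♭) (`IsRegistered.translate`).  GENERIC DISCRETE ANALYSIS · TRUE-type · ATTACKABLE · M. [this file, g36] -/
def WindowPoincareP (aHi : ℝ) : Prop :=
  ∀ δ : ℝ, 0 < δ → ∃ CP : ℝ, 1 ≤ CP ∧ ∃ R₁ : ℝ, 0 < R₁ ∧ ∀ S : Set E3, IsDoorSetP aHi δ S → ∀ R : ℝ, R₁ ≤ R →
    ∀ (u : E3 → E3) (τ : E3 → ℝ),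
      (∀ x ∈ atomsIn (μS S) 0 R, ∀ p ∈ atomsIn (μS S) 0 R, dist p x ≤ 4 → dist (u p) (u x) ≤ τ x) →
        ∃ t : E3, ∑ᶠ x ∈ atomsIn (μS S) 0 R, ‖u x - t‖ ^ 2 ≤ CP * R ^ 2 * ∑ᶠ x ∈ atomsIn (μS S) 0 R, τ x ^ 2

/-! ### XII.4  Glue, projections, column (PROVED) -/

/-- ★★ **(G♯) ∧ (G♭) ⇒ (G) (PROVED)** — the regime dichotomy is exhaustive: take (G♭)'s `c₀`, instantiate (G♯) at it, `C♭ := max`, ceiling `min`, floor `max`,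
and split on the sign of `η·R² − c₀`. [this file, g36] -/
theorem gradPinningP_of_thick_thin {aHi Λ θ s : ℝ} (hT : GradPinningThickP aHi Λ θ s) (ht : GradPinningThinP aHi Λ θ s) :
    GradPinningP aHi Λ θ s := by
  obtain ⟨c₀, hc₀, Ht⟩ := ht
  intro δ hδ a ha
  obtain ⟨C₁, hC₁, η₁, hη₁, R₁, hR₁, H₁⟩ := hT c₀ hc₀ δ hδ a ha
  obtain ⟨C₂, hC₂, η₂, hη₂, R₂, hR₂, H₂⟩ := Ht δ hδ a ha
  refine ⟨max C₁ C₂, le_max_of_le_left hC₁, min η₁ η₂, lt_min hη₁ hη₂, max R₁ R₂, lt_max_of_lt_left hR₁, ?_⟩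
  intro S hS hgood η hη hηle R hR hms L w' Ψ' τ' hE' hreg' w Ψ₀ hEw hbij hiso
  by_cases hc : c₀ ≤ η * R ^ 2
  · obtain ⟨w₁, Ψ₁, hE₁, hb₁, hi₁, ρ, τ₁, hr₁⟩ := H₁ S hS hgood η hη (hηle.trans (min_le_left _ _)) R ((le_max_left _ _).trans hR) hc
      hms L w' Ψ' τ' hE' hreg' w Ψ₀ hEw hbij hiso
    exact ⟨w₁, Ψ₁, hE₁, hb₁, hi₁, ρ, τ₁, hr₁.mono (mul_le_mul_of_nonneg_right (le_max_left _ _) hη.le)⟩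
  · obtain ⟨w₁, Ψ₁, hE₁, hb₁, hi₁, ρ, τ₁, hr₁⟩ := H₂ S hS hgood η hη (hηle.trans (min_le_right _ _)) R ((le_max_right _ _).trans hR)
      (not_le.mp hc) hms L w' Ψ' τ' hE' hreg' w Ψ₀ hEw hbij hiso
    exact ⟨w₁, Ψ₁, hE₁, hb₁, hi₁, ρ, τ₁, hr₁.mono (mul_le_mul_of_nonneg_right (le_max_right _ _) hη.le)⟩

/-- ★★ **(G) ∧ (P) ⇒ (B2♭) (PROVED)** — gradient pinning at a free position scale, then re-anchoring: apply (P) to the displacement `u = x − Ψ₁ x`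
(dominated by `τ₁` through clause (i) of the registration), translate chart and map by the Poincaré mean `t`; the translated chart is again an
equilibrium chart (`IsEquilChart.translate`), the translated map again a bijective bond isomorphism onto it, and the registration survives with the
position clause now at scale `R` (`IsRegistered.translate`).  `C♭ := C_P·C♭(G)`. [this file, g36] -/
theorem bondIsoPinningP_of_gradPinning_poincare {aHi Λ θ s : ℝ} (hG : GradPinningP aHi Λ θ s) (hP : WindowPoincareP aHi) :
    BondIsoPinningP aHi Λ θ s := by
  intro δ hδ a ha
  obtain ⟨Cb, hCb, η₁, hη₁, R₁, hR₁, HG⟩ := hG δ hδ a ha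
  obtain ⟨CP, hCP, R₂, hR₂, HP⟩ := hP δ hδ
  refine ⟨CP * Cb, one_le_mul_of_one_le_of_one_le hCP hCb, η₁, hη₁, max R₁ R₂, lt_max_of_lt_left hR₁, ?_⟩
  intro S hS hgood η hη hηle R hR hms L w' Ψ' τ' hE' hreg' w Ψ₀ hEw hbij hiso
  obtain ⟨w₁, Ψ₁, hE₁, hb₁, hi₁, ρ, τ₁, hr₁⟩ := HG S hS hgood η hη hηle R ((le_max_left _ _).trans hR) hms L w' Ψ' τ' hE' hreg' w Ψ₀ hEw hbij hiso
  have hCbη : 0 ≤ Cb * η := mul_nonneg (zero_le_one.trans hCb) hη.le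
  obtain ⟨t, ht⟩ := HP S hS R ((le_max_right _ _).trans hR) (fun x => x - Ψ₁ x) τ₁ (fun x hx p hp hd => by
    show dist (p - Ψ₁ p) (x - Ψ₁ x) ≤ τ₁ x
    rw [dist_eq_norm, sub_sub_sub_comm, ← dist_eq_norm]
    exact hr₁.2.2.2.1 x hx p hp hd)
  have hpos : ∑ᶠ x ∈ atomsIn (μS S) 0 R, ‖x - (Ψ₁ x + t)‖ ^ 2 ≤ CP * Cb * η * R ^ 2 * nK (atomsIn (μS S) 0 R) := by
    have e : ∀ x : E3, ‖x - (Ψ₁ x + t)‖ = ‖x - Ψ₁ x - t‖ := fun x => by rw [sub_add_eq_sub_sub]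
    simp only [e]
    refine ht.trans ?_
    calc CP * R ^ 2 * ∑ᶠ x ∈ atomsIn (μS S) 0 R, τ₁ x ^ 2 ≤ CP * R ^ 2 * (Cb * η * nK (atomsIn (μS S) 0 R)) :=
          mul_le_mul_of_nonneg_left hr₁.2.2.2.2.1 (mul_nonneg (zero_le_one.trans hCP) (sq_nonneg R))
      _ = CP * Cb * η * R ^ 2 * nK (atomsIn (μS S) 0 R) := by ring
  refine ⟨fun m => w₁ m + t, fun x => Ψ₁ x + t, hE₁.translate t, ?_, hi₁.translate t, τ₁, ?_⟩
  · rw [layeredHom_add_const]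
    exact bijOn_translate hb₁ t
  · rw [layeredHom_add_const]
    exact hr₁.translate (by rw [mul_assoc]; exact le_mul_of_one_le_left hCbη hCP) t hpos

/-- ★★★ **(B2♭) ⟸ (G♯) ∧ (G♭) ∧ (P) (PROVED)** — the node's glue. [this file, g36] -/
theorem bondIsoPinningP_of_pieces {aHi Λ θ s : ℝ} (hT : GradPinningThickP aHi Λ θ s) (ht : GradPinningThinP aHi Λ θ s)
    (hP : WindowPoincareP aHi) : BondIsoPinningP aHi Λ θ s :=
  bondIsoPinningP_of_gradPinning_poincare (gradPinningP_of_thick_thin hT ht) hP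

/-- ★ **(B2♭) ⇒ (G) (PROVED)**: forget the position scale (`ρ := R`). [this file, g36] -/
theorem gradPinningP_of_bondIsoPinningP {aHi Λ θ s : ℝ} (h : BondIsoPinningP aHi Λ θ s) : GradPinningP aHi Λ θ s := by
  intro δ hδ a ha
  obtain ⟨Cb, hCb, η₁, hη₁, R₁, hR₁, H⟩ := h δ hδ a ha
  refine ⟨Cb, hCb, η₁, hη₁, R₁, hR₁, fun S hS hgood η hη hηle R hR hms L w' Ψ' τ' hE' hreg' w Ψ₀ hEw hbij hiso => ?_⟩
  obtain ⟨w₁, Ψ₁, hE₁, hb₁, hi₁, τ₁, hr₁⟩ := H S hS hgood η hη hηle R hR hms L w' Ψ' τ' hE' hreg' w Ψ₀ hEw hbij hiso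
  exact ⟨w₁, Ψ₁, hE₁, hb₁, hi₁, R, τ₁, hr₁⟩

/-- ★ **(G) ⇒ (G♯) (PROVED)**: drop the regime hypothesis. [this file, g36] -/
theorem gradPinningThickP_of_gradPinningP {aHi Λ θ s : ℝ} (h : GradPinningP aHi Λ θ s) : GradPinningThickP aHi Λ θ s := by
  intro c₀ _ δ hδ a ha
  obtain ⟨Cb, hCb, η₁, hη₁, R₁, hR₁, H⟩ := h δ hδ a ha
  exact ⟨Cb, hCb, η₁, hη₁, R₁, hR₁, fun S hS hgood η hη hηle R hR _ => H S hS hgood η hη hηle R hR⟩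

/-- ★ **(G) ⇒ (G♭) (PROVED)**: drop the regime hypothesis (`c₀ := 1`). [this file, g36] -/
theorem gradPinningThinP_of_gradPinningP {aHi Λ θ s : ℝ} (h : GradPinningP aHi Λ θ s) : GradPinningThinP aHi Λ θ s := by
  refine ⟨1, one_pos, fun δ hδ a ha => ?_⟩
  obtain ⟨Cb, hCb, η₁, hη₁, R₁, hR₁, H⟩ := h δ hδ a ha
  exact ⟨Cb, hCb, η₁, hη₁, R₁, hR₁, fun S hS hgood η hη hηle R hR _ => H S hS hgood η hη hηle R hR⟩

/-- ★ **(B2♭) ⇒ (G♯) and (B2♭) ⇒ (G♭) (PROVED)**: neither regime piece exceeds the target. [this file, g36] -/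
theorem thick_and_thin_of_bondIsoPinningP {aHi Λ θ s : ℝ} (h : BondIsoPinningP aHi Λ θ s) :
    GradPinningThickP aHi Λ θ s ∧ GradPinningThinP aHi Λ θ s :=
  ⟨gradPinningThickP_of_gradPinningP (gradPinningP_of_bondIsoPinningP h),
    gradPinningThinP_of_gradPinningP (gradPinningP_of_bondIsoPinningP h)⟩

/-- ★ **non-vacuity of (P)**: a constant displacement (any profile dominating its zero oscillation) satisfies (P)'s conclusion with `t` the constant,
for every `C_P ≥ 0` (the right-hand side is a sum of squares). [this file, g36] -/
theorem windowPoincare_const (Q : Set E3) (c : E3) (τ : E3 → ℝ) (CP R : ℝ) (hCP : 0 ≤ CP) :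
    ∑ᶠ x ∈ Q, ‖(fun _ : E3 => c) x - c‖ ^ 2 ≤ CP * R ^ 2 * ∑ᶠ x ∈ Q, τ x ^ 2 := by
  have h0 : ∑ᶠ x ∈ Q, ‖(fun _ : E3 => c) x - c‖ ^ 2 = 0 := by simp
  rw [h0]
  exact mul_nonneg (mul_nonneg hCP (sq_nonneg R)) (finsum_nonneg fun x => finsum_nonneg fun _ => sq_nonneg (τ x))

/-- ★★★ **COLUMN `_16XH12` — TWENTY opaque leaves** (the node's three pieces in place of (B2♭) in part TI's eighteen-leaf `_16XH11`, where (B4) is already discharged by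
`bondIsoTearFreeP_one`): `LatticeLiouvilleCert → LayeredLiouvilleCert → R_G → X → Z_E → P → T → U♮ → B1 → G♯ → G♭ → P(oincaré) → A0♯⁺ → FF → E → A⁰ → D⁰ → C♭ → R_W →
PeriodicBulkGapDoor 2 → VisibleGap (1/50) ∧ PertRegime (1/50)` (all at `(aHi; Λ, θ, s) = (1; 2, 1/16, 1/50)`), via `_16XH11` with `h2 := bondIsoPinningP_of_pieces`.  Supersedes `_16XH11`.
Open leaves on the (A0)-line: (B1) [existence residual of record], (G♯) [tame existence + estimate], (G♭) [+ garbage detection], (P) [generic]. [this file, g36] -/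
theorem gap_and_pert_1_50_of_certs_16XH12 (hL : LatticeLiouvilleCert) (hL' : LayeredLiouvilleCert)
    (hR : OscRigidityL2BDPG 1 2 (1 / 16) (1 / 16)) (hX : ExcessFlatnessControlP 1 2 (1 / 16) (1 / 16))
    (hE : ExcessChartLocalisationP 1 2 (1 / 16) (1 / 50)) (hP : RegistrationP 1 2 (1 / 16) (1 / 50))
    (hT : TailDominationCert) (hU : UniformTameStability (1 / 50) 2)
    (h1 : WordTransplantP 1 2 (1 / 16) (1 / 50)) (hGT : GradPinningThickP 1 2 (1 / 16) (1 / 50)) (hGt : GradPinningThinP 1 2 (1 / 16) (1 / 50))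
    (hPc : WindowPoincareP 1) (hl : BondIsoLevelsP 1 2 (1 / 16) (1 / 50))
    (hF : TailForceSlavingP 1 2 (1 / 16) (1 / 50))
    (hE' : LipDualLinearisationP 1 2 (1 / 16) (1 / 50)) (hA : L2HarmonicApproxP 1 2 (1 / 16) (1 / 50))
    (hD : PositionDecayPL 1 2 (1 / 16) (1 / 50)) (hC : PositionCaccioppoliPG 1 2 (1 / 16) (1 / 50))
    (hW : WildFractionPG 1 2 (1 / 16) (1 / 50)) (hG : PeriodicBulkGapDoor 2) : VisibleGap (1 / 50) ∧ PertRegime (1 / 50) :=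
  gap_and_pert_1_50_of_certs_16XH11 hL hL' hR hX hE hP hT hU h1 (bondIsoPinningP_of_pieces hGT hGt hPc) hl hF hE' hA hD hC hW hG

/-- ★ **COLUMN `_16XH12W`** — the same with (A1) «WildReRegistrationPG» in place of (R_W).  Supersedes `_16XH11W`. [this file, g36] -/
theorem gap_and_pert_1_50_of_certs_16XH12W (hL : LatticeLiouvilleCert) (hL' : LayeredLiouvilleCert)
    (hR : OscRigidityL2BDPG 1 2 (1 / 16) (1 / 16)) (hX : ExcessFlatnessControlP 1 2 (1 / 16) (1 / 16))
    (hE : ExcessChartLocalisationP 1 2 (1 / 16) (1 / 50)) (hP : RegistrationP 1 2 (1 / 16) (1 / 50))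
    (hT : TailDominationCert) (hU : UniformTameStability (1 / 50) 2)
    (h1 : WordTransplantP 1 2 (1 / 16) (1 / 50)) (hGT : GradPinningThickP 1 2 (1 / 16) (1 / 50)) (hGt : GradPinningThinP 1 2 (1 / 16) (1 / 50))
    (hPc : WindowPoincareP 1) (hl : BondIsoLevelsP 1 2 (1 / 16) (1 / 50))
    (hF : TailForceSlavingP 1 2 (1 / 16) (1 / 50))
    (hE' : LipDualLinearisationP 1 2 (1 / 16) (1 / 50)) (hA : L2HarmonicApproxP 1 2 (1 / 16) (1 / 50))
    (hD : PositionDecayPL 1 2 (1 / 16) (1 / 50)) (hC : PositionCaccioppoliPG 1 2 (1 / 16) (1 / 50))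
    (hw : WildReRegistrationPG 1 2 (1 / 16) (1 / 50)) (hG : PeriodicBulkGapDoor 2) : VisibleGap (1 / 50) ∧ PertRegime (1 / 50) :=
  gap_and_pert_1_50_of_certs_16XH11W hL hL' hR hX hE hP hT hU h1 (bondIsoPinningP_of_pieces hGT hGt hPc) hl hF hE' hA hD hC hw hG

end Summit.AtomisticToContinuum.Crystallization.Theorems.ChartedZeroExcessLayeredLatticeLiouville

end
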